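import Summits.BirchSwinnertonDyer.BirchSwinnertonDyer.Theorems.SmallImageMuTransferMuTransferX9LocalSplitPrime
import Literature.NumberTheory.GaloisRepresentations.LocalDualityTwoZero
import Literature.NumberTheory.GaloisRepresentations.PrimeToPEulerChar
import Literature.Algebra.Module.FiniteModuleTorsionCard
import Literature.GroupTheory.FiniteAbelian.UnitAddCircleDuality
import Mathlib.LinearAlgebra.Eigenspace.Zero
import Mathlib.Topology.Instances.AddCircle.Real
import HarnessLib

/-!
# K6 crux `MuTransferX9` (stmt-BirchSwinnertonDyer-19276), skeleton v5, G1-LOCAL input (file 1 of 2):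
# the UNIFORM ORDER BOUND `#H¹(K_v, 𝒯_J) ≤ #M^{2·p^m}` at a place `v ∤ p`, for every level `J`

Cell `bsd-smallim`, seat `bsd-smallim-k6-g4` gen 0 (route `SmallImageMuTransfer`, rung K6, leaf
`Rank1Residual.BSDpOnClassX9`), brief HOME/plan/k6/briefs/BRIEF-k6-g4-G1-local-exponent.md (plan g8).
HONEST FRAMING: TOOL theorems of local Galois cohomology; no definition, no named fact, no `sorry`;
nothing is asserted about any curve and nothing is booked; class X9 stays TYPED at class level. Serves
the OPEN registered stub `stub_coreX9` of crux 19276 as the "uniform local exponent at the bad primes"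
input of k6-c2 g3's G1 design note (STATUS l.235: "at `v ∈ S ∖ {p}` the whole `H¹(ℚ_v, 𝒯_J)` has
order `≤ p^{4·p^{s_v}}`, uniformly in `J`") — support UNDER k6-c2's G1 (no claim on the G1 stub) —
and credits nothing toward the crux (`--supports … --as helper`).  PARTITION (D-0054): X9 (A4) ×
p ∈ {5, 7}; the statements are prime- and field-generic (any number field `K`, any finite discrete
`p`-torsion `M`, any `ℤ_p`-extension `κ` — so the dual twist `κ⁻¹.twistModP ρ′ J` of k6-ty's
`IwasawaTwistModPDual` is covered VERBATIM, `κ.invTwist` being a `ZpExtension` with the same layers),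
so also X10b ∧ ¬Surj at 3 — helper; closes NONE.

## The mathematics (MU-TRANSFER-PROOF (F6) / §5 STEP 1 "`T^ε · loc_v y = 0`", made uniform in `J`)

`𝒯_J = κ.twistModP ρ J = M ⊗ 𝔽_p[T]/T^J (χ_κ)` (k6-ty `IwasawaTwistModP`), `v` a finite place of `K`,
`𝒯_J|_v = GaloisRep.toLocal v 𝒯_J`.  Fix ANY `g ∈ Γ_{K_v}` with `ρ(res g) = 1` whose restriction has
DEPTH `m` in the tower (`res g ∈ Gal(K̄/K_m) ∖ Gal(K̄/K_{m+1})`).  No Frobenius, unramifiedness or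
reduction-type hypothesis at `v` is used, and NO eigenvalue case analysis (the unipotent-Frobenius case
the brief flags is absorbed: we never look at `ρ(Frob_v)`).
* §1 `#H⁰(K_v, 𝒯_J) ≤ #M^{p^m}`: the invariants lie in the fixed points of `g`, which are
  `𝒯_J[T^{p^m}]` (koly's `toLocal_twistModP_apply_eq_self_iff_of_split`: `g` acts as `(1+T)^{p^m u}`,
  `p ∤ u`), of order `#M^{min(J, p^m)}` (`natCard_shiftEnd_pow_ker`).
* §2 `#H²(K_v, 𝒯_J) ≤ #M^{p^m}` if `g` also fixes `μ_p`: the tree's PROVED local duality in bidegree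
  `(2,0)` `natCard_two_eq_natCard_invariants_homRep` (`#H² = #Hom_Γ(𝒯_J, μ_p)`, Milne I Cor. 2.3);
  an equivariant `f` factors through the co-invariants `𝒯_J/(g−1)`, whose order is that of the fixed
  points (`#ker = #coker`, tree `natCard_ker_eq_natCard_quotient_range`), and `#Hom(B, μ_p) ≤ #B`
  (`μ_p ≅ ℤ/p ↪ ℝ/ℤ`, tree `natCard_addMonoidHom_unitAddCircle`).
* §3 `#H¹(K_v, 𝒯_J) ≤ #M^{2·p^m}` at `v ∤ p`: the tree's PROVED Euler–Poincaré characteristic for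
  `p`-primary modules at residue characteristic `≠ p`, `natCard_invariants_mul_natCard_two_eq`
  (Milne I Thm. 2.8 / Serre II §5.7).
* §0 two counting lemmas: `#Hom(B, ℤ/n) ≤ #B`; a nilpotent endomorphism of a finite `𝔽_p`-space of
  order `≤ p^ε` has `T^ε = 0` (Cayley–Hamilton) — the latter is used in file 2
  (`…X9LocalExponentBadPrimesUniform.lean`: the exponent `T_v^[2d·p^m] = 0`, the existence of `g`
  from any `τ` with `κ(res τ) ≠ 1`, and the packaging `∃ ε_v ∀ J`).
The hypothesis "`κ` non-trivial on `Γ_{K_v}`" is NECESSARY: at a place split completely in `K_∞/K`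
the invariants `M^{Γ_v} ⊗ A_J` grow with `J`.  Over `ℚ` (cyclotomic `κ`) every finite prime is
finitely decomposed, and an element of depth `s_v` gives the brief's `ε_v = 4·p^{s_v}` for `M = E[p]`.

References: HOME/koly/MU-TRANSFER-PROOF.md (F6), §5 STEP 1; J. S. Milne, *Arithmetic Duality
Theorems* (2006) I Cor. 2.3, Thm. 2.8 [MilneADT2006]; J.-P. Serre, *Galois Cohomology* (1997) II §5.2,
§5.7 [SerreGaloisCohomology1997]; B. Mazur, K. Rubin, Mem. AMS 799 (2004) Lemma 5.3.1 (`H¹(I_ℓ, 𝕋)^{Fr=0}`: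
the Frobenius acts on `Λ` through an element of infinite order) [MazurRubin2004]; L. Washington,
*Introduction to Cyclotomic Fields* §13 [Washington1997].
-/

set_option linter.dupNamespace false
set_option autoImplicit false

noncomputable section

open scoped Classical ContRepresentation

universe u

namespace Summit.BirchSwinnertonDyer.BirchSwinnertonDyer.Rank1Residual.LocalSplitPrime

/-! ## §0 Two counting lemmas -/

section Algebra

open Literature.GroupTheory.FiniteAbelian

/-- `#Hom(B, ℤ/n) ≤ #B` for a finite abelian group `B` (`ℤ/n ↪ ℝ/ℤ` and `#Hom(B, ℝ/ℤ) = #B`).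
[folklore] -/
theorem natCard_addMonoidHom_zmod_le (B : Type*) [AddCommGroup B] [Finite B] (n : ℕ) [NeZero n] :
    Nat.card (B →+ ZMod n) ≤ Nat.card B := by
  haveI := finite_addMonoidHom_unitAddCircle B
  rw [← natCard_addMonoidHom_unitAddCircle B]
  refine Nat.card_le_card_of_injective (fun f => (ZMod.toAddCircle : ZMod n →+ UnitAddCircle).comp f)
    fun f g hfg => ?_
  ext b
  exact ZMod.toAddCircle_injective n (DFunLike.congr_fun hfg b)

/-- **A nilpotent endomorphism of a finite `𝔽_p`-vector space of order `≤ p^ε` satisfies `T^ε = 0`.**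
For a finite additive group `B` killed by the prime `p`, an additive `T : B → B` some iterate of which
vanishes, and `#B ≤ p^ε`: `T^[ε] = 0` (Cayley–Hamilton: `T^{dim} = 0`, and `p^{dim} = #B ≤ p^ε`).
[folklore] -/
theorem iterate_eq_zero_of_nilpotent_of_natCard_le {B : Type*} [AddCommGroup B] [Finite B] {p : ℕ}
    [hp : Fact p.Prime] (hB : ∀ b : B, p • b = 0) (T : B →+ B) {k : ℕ} (hk : ∀ b, T^[k] b = 0)
    {ε : ℕ} (hε : Nat.card B ≤ p ^ ε) (b : B) : T^[ε] b = 0 := by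
  -- `haveI`, not `letI`: the `match p` in `zmodModule` must stay opaque for the `→ₗ[ZMod p]` coercions
  haveI : Module (ZMod p) B := AddCommGroup.zmodModule hB
  haveI : Module.Finite (ZMod p) B := Module.Finite.of_finite
  let L : Module.End (ZMod p) B := T.toZModLinearMap p
  have hL : ∀ (j : ℕ) (x : B), (L ^ j) x = T^[j] x := fun j x => by
    rw [Module.End.pow_apply]; rfl
  have hnil : IsNilpotent L := ⟨k, LinearMap.ext fun x => by rw [hL]; exact hk x⟩
  -- Cayley–Hamilton: `L ^ finrank = 0`
  have hch := LinearMap.aeval_self_charpoly L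
  rw [hnil.charpoly_eq_X_pow_finrank, map_pow, Polynomial.aeval_X] at hch
  -- `finrank ≤ ε`
  have hcard : Nat.card B = p ^ Module.finrank (ZMod p) B := by
    rw [Module.natCard_eq_pow_finrank (K := ZMod p) (V := B), Nat.card_zmod]
  have hle : Module.finrank (ZMod p) B ≤ ε :=
    (Nat.pow_le_pow_iff_right hp.out.one_lt).1 (hcard ▸ hε)
  obtain ⟨r, hr⟩ := Nat.exists_eq_add_of_le hle
  have h0 : T^[Module.finrank (ZMod p) B] b = 0 := by
    rw [← hL, hch]; rfl
  rw [hr, add_comm, Function.iterate_add_apply, h0, ← hL, map_zero]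

end Algebra

open CategoryTheory ContinuousCohomology Function Field ValuativeRel NumberField IsDedekindDomain
open Literature.NumberTheory.GaloisRepresentations
open Literature.NumberTheory.GaloisRepresentations.IsNonarchimedeanLocalField
open _root_.TopRep
open Literature.NumberTheory.GaloisCohomology
open Literature.NumberTheory.EllipticCurves


/-! ## §1 Invariants: `#H⁰(K_v, 𝒯_J) ≤ #M^{p^m}` for ANY `ρ`-trivial element of depth `m` -/

section Invariants

variable {K : Type u} [Field K] [NumberField K] {M : Type u} [AddCommGroup M] [TopologicalSpace M]
  [DiscreteTopology M] [Finite M] (ρ : DiscreteGaloisModule K M) {p : ℕ} [Fact p.Prime]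
  (hM : ∀ x : M, p • x = 0) (κ : ZpExtension K p) (J : ℕ) (v : HeightOneSpectrum (𝓞 K))

omit [AddCommGroup M] [TopologicalSpace M] [DiscreteTopology M] [Finite M] [Fact p.Prime] in
/-- `#𝒯_J = #M^J`. [cite: Washington1997, §13.1–§13.2] -/
theorem natCard_coordinateModule : Nat.card (Fin J → M) = Nat.card M ^ J := by
  rw [Nat.card_fun, Nat.card_fin]

/-- **Fixed points of a `ρ`-trivial element of depth `m` are few, uniformly in `J`.**  For
`g ∈ Γ_{K_v}` with `ρ(res g) = 1` and `res g ∈ Gal(K̄/K_m) ∖ Gal(K̄/K_{m+1})`: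
`#{x ∈ 𝒯_J : g·x = x} ≤ #M^{p^m}` (the fixed points are `𝒯_J[T^{p^m}]`, koly's
`toLocal_twistModP_apply_eq_self_iff_of_split`, of order `#M^{min(J, p^m)}`).
[cite: Washington1997, §13.1–§13.2] -/
theorem natCard_fixedPoints_toLocal_twistModP_le_of_depth
    {g : absoluteGaloisGroup (v.adicCompletion K)}
    (hg : ρ (absGaloisRestrict K (v.adicCompletion K) g) = 1) {m : ℕ}
    (hgm : absGaloisRestrict K (v.adicCompletion K) g ∈ κ.layerSubgroup m)
    (hgm' : absGaloisRestrict K (v.adicCompletion K) g ∉ κ.layerSubgroup (m + 1)) :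
    Nat.card {x : Fin J → M // GaloisRep.toLocal v (κ.twistModP ρ hM J) g x = x} ≤
      Nat.card M ^ (p ^ m) := by
  have hMpos : 0 < Nat.card M := Nat.card_pos
  by_cases hpm : p ^ m ≤ J
  · have hJ : m + 1 ≤ J := (Nat.lt_pow_self (Fact.out : p.Prime).one_lt).trans_le hpm
    rw [Nat.card_congr (Equiv.subtypeEquivRight fun x =>
      toLocal_twistModP_apply_eq_self_iff_of_split ρ hM κ J v hg hJ hgm hgm' x),
      natCard_shiftEnd_pow_ker J hpm]
  · calc Nat.card {x : Fin J → M // GaloisRep.toLocal v (κ.twistModP ρ hM J) g x = x}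
        ≤ Nat.card (Fin J → M) :=
          Nat.card_le_card_of_injective (fun x => x.1) Subtype.val_injective
      _ = Nat.card M ^ J := natCard_coordinateModule J
      _ ≤ Nat.card M ^ (p ^ m) := Nat.pow_le_pow_right hMpos (by omega)

/-- **Uniform bound on the local invariants of the twist.**  Let `v` be a finite place of `K` and
`g ∈ Γ_{K_v}` an element whose restriction to `K̄` acts trivially on `M` (`ρ(res g) = 1`) and has
DEPTH `m` in the `ℤ_p`-tower of `κ` (`res g ∈ Gal(K̄/K_m) ∖ Gal(K̄/K_{m+1})`).  Then for EVERY level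
`J`, `#H⁰(K_v, 𝒯_J) ≤ #M^{p^m}` (the invariants lie in the fixed points of `g`).  No Frobenius,
unramifiedness or reduction hypothesis at `v` is needed — only that `κ|_{Γ_{K_v}}` is non-trivial on
`ker ρ|_{Γ_{K_v}}` (such a `g` exists iff `v` is finitely decomposed in `K_∞`, see
`exists_split_depth_of_apply_ne_one`; at a place split completely in `K_∞/K` the invariants
`M^{Γ_v} ⊗ A_J` grow with `J`).  MU-TRANSFER-PROOF (F6) ("`H⁰(ℚ_v, 𝒯^∨)` is finite: `G_{ℚ_v}` acts
on `Ω^∨(χ^{-1})` through an open subgroup of `Γ`"), levelwise and uniformly in the level.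
[cite: Washington1997, §13.1–§13.2] [cite: MazurRubin2004, Lemma 5.3.1] -/
theorem natCard_invariants_toLocal_twistModP_le_of_depth
    {g : absoluteGaloisGroup (v.adicCompletion K)}
    (hg : ρ (absGaloisRestrict K (v.adicCompletion K) g) = 1) {m : ℕ}
    (hgm : absGaloisRestrict K (v.adicCompletion K) g ∈ κ.layerSubgroup m)
    (hgm' : absGaloisRestrict K (v.adicCompletion K) g ∉ κ.layerSubgroup (m + 1)) :
    Nat.card (GaloisRep.toLocal v (κ.twistModP ρ hM J)).toTopRep.ρ.invariants ≤
      Nat.card M ^ (p ^ m) :=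
  (Nat.card_le_card_of_injective
    (fun x : (GaloisRep.toLocal v (κ.twistModP ρ hM J)).toTopRep.ρ.invariants =>
      (⟨x.1, x.2 g⟩ : {x : Fin J → M // GaloisRep.toLocal v (κ.twistModP ρ hM J) g x = x}))
    (fun x y hxy => Subtype.ext (by simpa using congrArg Subtype.val hxy))).trans
    (natCard_fixedPoints_toLocal_twistModP_le_of_depth ρ hM κ J v hg hgm hgm')

end Invariants

/-! ## §2 `#H²(K_v, 𝒯_J) ≤ #M^{p^m}`: local duality in bidegree `(2, 0)` (PROVED in the tree) and the
coinvariants of `g` -/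

section HTwo

variable {K : Type u} [Field K] [NumberField K] {M : Type u} [AddCommGroup M] [TopologicalSpace M]
  [DiscreteTopology M] [Finite M] (ρ : DiscreteGaloisModule K M) {p : ℕ} [Fact p.Prime]
  (hM : ∀ x : M, p • x = 0) (κ : ZpExtension K p) (J : ℕ) (v : HeightOneSpectrum (𝓞 K))

/-- **Uniform bound on `H²`.**  For `g ∈ Γ_{K_v}` as in §1 which moreover fixes the `p`-th roots of
unity of `K̄_v` (`hμ`), and every level `J`: `#H²(K_v, 𝒯_J) ≤ #M^{p^m}`.  By the tree's PROVED local
duality in bidegree `(2, 0)` (`natCard_two_eq_natCard_invariants_homRep`, Milne I Cor. 2.3: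
`#H²(K_v, 𝒯_J) = #Hom_{Γ_{K_v}}(𝒯_J, μ_p)`), an equivariant `f : 𝒯_J → μ_p` satisfies
`f(g x) = g f(x) = f(x)`, i.e. factors through the co-invariants `𝒯_J/(g − 1)𝒯_J`, whose order is
that of the fixed points of `g` (`#ker = #coker` for an endomorphism of a finite group), `≤ #M^{p^m}`
(§1); and `#Hom(B, μ_p) ≤ #B`. [cite: MilneADT2006, Ch. I, Cor. 2.3] [cite: SerreGaloisCohomology1997, II §5.2 Thm. 2] -/
theorem natCard_galoisCohomology_two_toLocal_twistModP_le_of_depth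
    {g : absoluteGaloisGroup (v.adicCompletion K)}
    (hg : ρ (absGaloisRestrict K (v.adicCompletion K) g) = 1)
    (hμ : ∀ ζ : (AlgebraicClosure (v.adicCompletion K))ˣ, ζ ^ p = 1 → g • ζ = ζ) {m : ℕ}
    (hgm : absGaloisRestrict K (v.adicCompletion K) g ∈ κ.layerSubgroup m)
    (hgm' : absGaloisRestrict K (v.adicCompletion K) g ∉ κ.layerSubgroup (m + 1)) :
    Nat.card (galoisCohomology (GaloisRep.toLocal v (κ.twistModP ρ hM J)) 2) ≤ Nat.card M ^ (p ^ m) := by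
  set F := v.adicCompletion K
  haveI : CharZero F := charZero_adicCompletion v
  haveI : NeZero (p ^ 1) := ⟨pow_ne_zero _ (Fact.out : p.Prime).ne_zero⟩
  set T := GaloisRep.toLocal v (κ.twistModP ρ hM J) with hT
  have hM1 : ∀ x : Fin J → M, p ^ 1 • x = 0 := fun x => by
    rw [pow_one]; funext i; exact hM (x i)
  -- local duality (2,0), PROVED in the tree
  obtain ⟨-, hcard⟩ := natCard_two_eq_natCard_invariants_homRep F T hM1
  change Nat.card (continuousCohomology 2 T.toTopRep) ≤ _
  rw [hcard]
  -- the endomorphism `g − 1` of `𝒯_J` and its cokernel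
  set f0 : Module.End ℤ (Fin J → M) := (T g : (Fin J → M) →ₗ[ℤ] (Fin J → M)) - 1 with hf0
  haveI : Finite (DiscreteGaloisModule.MuCarrier F (p ^ 1)) := finite_muCarrier F (p ^ 1)
  haveI : Finite ((Fin J → M) ⧸ LinearMap.range f0) :=
    Finite.of_surjective _ (Submodule.mkQ_surjective _)
  -- `g` acts trivially on `μ_{p}`
  have hμ1 : ∀ ζ : (AlgebraicClosure F)ˣ, ζ ^ (p ^ 1) = 1 → g • ζ = ζ := fun ζ h =>
    hμ ζ (by rwa [pow_one] at h)
  have hμ' : ∀ ζ : DiscreteGaloisModule.MuCarrier F (p ^ 1), DiscreteGaloisModule.mu F (p ^ 1) g ζ = ζ := by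
    intro ζ
    apply (DiscreteGaloisModule.MuCarrier.toAdditive (K := F)).injective
    rw [DiscreteGaloisModule.mu_apply_apply]
    refine congrArg Additive.ofMul (Subtype.ext ?_)
    rw [absoluteGaloisGroup.coe_smul_rootsOfUnity]
    exact hμ1 _ ((DiscreteGaloisModule.MuCarrier.toAdditive ζ).toMul).2
  -- every invariant of `Hom(𝒯_J, μ_p)` kills `(g − 1)𝒯_J`
  have hkill : ∀ f : (T.homRep (DiscreteGaloisModule.mu F (p ^ 1))).toTopRep.ρ.invariants,
      LinearMap.range f0 ≤
        LinearMap.ker ((f.1 : (Fin J → M) →+ DiscreteGaloisModule.MuCarrier F (p ^ 1)).toIntLinearMap) := by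
    rintro f _ ⟨x, rfl⟩
    rw [LinearMap.mem_ker, AddMonoidHom.coe_toIntLinearMap, hf0, LinearMap.sub_apply,
      Module.End.one_apply, map_sub, sub_eq_zero]
    have h := (ContinuousRep.homRep_apply_eq_self_iff T (DiscreteGaloisModule.mu F (p ^ 1)) g f.1).1
      (f.2 g) x
    rw [hμ'] at h
    exact h.symm
  -- so `Hom_Γ(𝒯_J, μ_p) ↪ Hom(𝒯_J/(g−1), μ_p)`
  have hinj : Nat.card (T.homRep (DiscreteGaloisModule.mu F (p ^ 1))).toTopRep.ρ.invariants ≤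
      Nat.card (((Fin J → M) ⧸ LinearMap.range f0) →+ DiscreteGaloisModule.MuCarrier F (p ^ 1)) := by
    haveI : Finite (((Fin J → M) ⧸ LinearMap.range f0) →+ DiscreteGaloisModule.MuCarrier F (p ^ 1)) :=
      Finite.of_injective (fun φ => (φ : _ → DiscreteGaloisModule.MuCarrier F (p ^ 1)))
        DFunLike.coe_injective
    refine Nat.card_le_card_of_injective
      (fun f => ((LinearMap.range f0).liftQ _ (hkill f)).toAddMonoidHom) fun f f' hff' => ?_
    apply Subtype.ext
    apply HomCarrier.ext
    intro x
    have h := DFunLike.congr_fun hff' (Submodule.Quotient.mk x)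
    simp only [LinearMap.toAddMonoidHom_coe, Submodule.liftQ_apply, AddMonoidHom.coe_toIntLinearMap] at h
    exact h
  refine hinj.trans ?_
  -- `#Hom(B, μ_p) ≤ #B = #ker(g − 1) ≤ #M^{p^m}`
  have hΩ : Nat.card (((Fin J → M) ⧸ LinearMap.range f0) →+ DiscreteGaloisModule.MuCarrier F (p ^ 1)) =
      Nat.card (((Fin J → M) ⧸ LinearMap.range f0) →+ ZMod (p ^ 1)) :=
    Nat.card_congr (AddEquiv.addMonoidHomCongrRightEquiv (muEquivZMod F (p ^ 1)))
  rw [hΩ]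
  refine (natCard_addMonoidHom_zmod_le _ (p ^ 1)).trans ?_
  rw [← Literature.Algebra.Module.natCard_ker_eq_natCard_quotient_range f0]
  refine le_trans (le_of_eq (Nat.card_congr (Equiv.subtypeEquivRight fun x => ?_)))
    (natCard_fixedPoints_toLocal_twistModP_le_of_depth ρ hM κ J v hg hgm hgm')
  rw [LinearMap.mem_ker, hf0, LinearMap.sub_apply, Module.End.one_apply, sub_eq_zero]

end HTwo

/-! ## §3 `#H¹(K_v, 𝒯_J) ≤ #M^{2·p^m}` at `v ∤ p`: the local Euler–Poincaré characteristic (PROVED in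
the tree for modules of order prime to the residue characteristic) -/

section HOne

variable {K : Type u} [Field K] [NumberField K] {M : Type u} [AddCommGroup M] [TopologicalSpace M]
  [DiscreteTopology M] [Finite M] (ρ : DiscreteGaloisModule K M) {p : ℕ} [Fact p.Prime]
  (hM : ∀ x : M, p • x = 0) (κ : ZpExtension K p) (J : ℕ) (v : HeightOneSpectrum (𝓞 K))

/-- **Uniform bound on `#H¹(K_v, 𝒯_J)` at a place `v ∤ p`.**  For `g ∈ Γ_{K_v}` with `ρ(res g) = 1`,
fixing `μ_p`, of depth `m`, and every level `J`: **`#H¹(K_v, 𝒯_J) ≤ #M^{2·p^m}`** — the local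
Euler–Poincaré characteristic `#H⁰ · #H² = #H¹` for the `p`-primary module `𝒯_J` at `v ∤ p` (the
tree's PROVED `natCard_invariants_mul_natCard_two_eq`, Milne I Thm. 2.8 / Serre II §5.7) with §1 and
§2.  This is the "uniform local exponent" input of k6-c2's G1 design note (crux 19276, skeleton v5):
the order of the whole local cohomology at a bad prime is bounded independently of `J`.
[cite: MilneADT2006, Ch. I §2, Thm. 2.8 (p. 31)] [cite: SerreGaloisCohomology1997, II §5.7 Thm. 5] -/
theorem natCard_galoisCohomology_one_toLocal_twistModP_le_of_depth
    (hpv : (p : 𝓞 K) ∉ v.asIdeal)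
    {g : absoluteGaloisGroup (v.adicCompletion K)}
    (hg : ρ (absGaloisRestrict K (v.adicCompletion K) g) = 1)
    (hμ : ∀ ζ : (AlgebraicClosure (v.adicCompletion K))ˣ, ζ ^ p = 1 → g • ζ = ζ) {m : ℕ}
    (hgm : absGaloisRestrict K (v.adicCompletion K) g ∈ κ.layerSubgroup m)
    (hgm' : absGaloisRestrict K (v.adicCompletion K) g ∉ κ.layerSubgroup (m + 1)) :
    Nat.card (galoisCohomology (GaloisRep.toLocal v (κ.twistModP ρ hM J)) 1) ≤
      Nat.card M ^ (2 * p ^ m) := by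
  set F := v.adicCompletion K
  haveI : CharZero F := charZero_adicCompletion v
  set T := GaloisRep.toLocal v (κ.twistModP ρ hM J) with hT
  have hprim : IsPrimaryTorsion p (Fin J → M) := fun x => ⟨1, by
    rw [pow_one]; funext i; exact hM (x i)⟩
  obtain ⟨-, hEP⟩ := natCard_invariants_mul_natCard_two_eq F T hprim
    (v.ringChar_residueField_adicCompletion_ne hpv).symm
  change Nat.card (continuousCohomology 1 T.toTopRep) ≤ _
  rw [← hEP, two_mul, pow_add]
  exact Nat.mul_le_mul (natCard_invariants_toLocal_twistModP_le_of_depth ρ hM κ J v hg hgm hgm')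
    (natCard_galoisCohomology_two_toLocal_twistModP_le_of_depth ρ hM κ J v hg hμ hgm hgm')

end HOne

end Summit.BirchSwinnertonDyer.BirchSwinnertonDyer.Rank1Residual.LocalSplitPrime

end
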